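import Summits.QuantumFields.YangMills.Theorems.UnitScaleTiltProp7FibreLevelSup
import Literature.MathematicalPhysics.QuantumFieldTheory.Balaban1983to89.T4AxialGaugeSmallField
import HarnessLib

/-!
# Route `UnitScaleTilt`, crux K1 «MinimiserStabilityRegPr» (stmt-QuantumFields-19200), route-R [RP] curved, the `Q`-junction (R2), file D′ —
# THE (T1)-TYPE LOCAL-GAUGE INPUT OF ✓ `Prop7FibreLevelSup` IS A THEOREM: plaquette-small `U₀` ⇒ an `η`-flat axial gauge over the two `j`-blocks of a
# `j`-bond ∕ over the two-block neighbourhood of a `(j+1)`-bond, `η = (d−1)·2L^j·δ` ∕ `(d−1)·3L^{j+1}·δ`; hence the per-level sups and the two-block masses `μ_j`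
# of the level ratios from the (14)-type plaquette bound and the competitor's sup ALONE

Cell `ym3-torus`, keyed width hand `ym-routeR-w1` gen 2 (D-0154 (3c); residual (iii) of ★routeR-w3 s2's route-R census 2026-08-28 09:43Z: «per-level sups `μ_j` —
✓ `…FibreLevelSup` reduces them to (T1)-type local η-flat gauges on j-block stencils»).  THEOREMS ONLY (0 `def`, 0 `sorry`); `--supports stmt-QuantumFields-19200`,
count-neutral.  YM₃ on T³ is a ladder rung (R3), not the Clay problem; nothing here claims the stub, the crux, d = 4 or the mass gap.

THE POINT.  ✓ `Prop7FibreLevelSup.norm_pertVar_iter_le_of_gauge` ∕ `twoBlockMass_le_of_gauge` (★routeR-w3 s2) bound the level-`j` ratios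
`Y_j = pertVar Ū₀^{(j)} W̄^{(j)}` by `2(d+1)L^j·ρ` from FOUR DISPLAYED local-gauge data: a finest gauge `σ`, a stencil `N` over the relevant `j`-blocks, the flatness
`‖(U₀^σ)_e − 1‖ ≤ η` on the finest bonds inside `N`, and the sup `‖W − U₀‖ ≤ ρ` there.  The first three are NOT data: they follow from the route's (14)-type
plaquette bound `dist1 (U₀(∂p)) ≤ δ` (`δ = ε·ℓ⁻²`) by the lattice non-abelian Poincaré lemma — in the axial gauge of a non-wrapping box every bond variable is
within `(d−1)·(side)·δ` of `1` ([Balaban1985Averaging] p. 24 l. −2 – p. 25 l. 2; [Balaban1987RG1] (1.11)–(1.12)) — which the tree HOLDS on the torus carrier of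
`Setup` as ✓ `T4AxialGaugeSmallField.dist1_axial_bond_le_uniform` ∕ `gaugeAct_axialGauge_castSite` (pub-balaban pv26), used here BY NAME.  This file is the
KNIT: (§1) the finest sites over a (multi-)shifted coarse block `w + t` are the image under `castSite` of the integer label box `[(w+t)·L^k, (w+t+1)·L^k − 1]`
(labels NOT reduced modulo the period, so the wrap of `T^{(k)}` costs nothing: `(a mod N_k)·L^k ≡ a·L^k (mod N_0)` because `N_0 = N_k·L^k`); (§2) on the image
of a box with the injectivity margin `side + 1 < sitesPerDir` a bond with both ends in the image IS a box bond, so the `≤`-form of the plaquette bound gives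
`dist1 (U₀^{axialGauge}(e)) ≤ (d−1)·n·δ`; (§3) the two `j`-blocks of a `j`-bond sit in a box of `2L^j` labels per direction (`j < m + K`), (§4) the two-block
neighbourhood of a `(j+1)`-bond (`blockOf b₋ ∈ {c₋, c₊}`, both `j`-blocks of each such `b`; ✓ `B10StarCount.blockOf_shift`) in a box of `3L^{j+1}` labels
(`j + 1 < m + K`, `3 ≤ L`); (§5) the two ✓ `Prop7FibreLevelSup` theorems with `(σ, N, hN, hU₀)` discharged (`dist1` on `SU(n)` IS the matrix norm, `rfl`).

WHAT IS PROVED (ns `…Theorems.Prop7FibreLevelSupLocalGauge`; any `Params`; §2–§4 for ANY `GaugeGroup`, §5 for `SU(n)`).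
* §1 `two_mul_pow_lt_sitesPerDir_zero`, `three_mul_pow_lt_sitesPerDir_zero`; ★ `exists_rep_of_iterBlockOf`,
  `mem_image_box_of_iterBlockOf` (the label box of a shifted block); `shift_apply_eq_add`, `exists_multishift_of_eq_or_eq_shift`.
* §2 `boxPlaqSmall_pull_of_le`; ★★ `dist1_gaugeAct_axialGauge_le_of_mem_image` — the axial gauge of a non-wrapping box is `(d−1)·n·δ`-flat on the image of the box.
* §3 ★★ `exists_flatGauge_twoBlocks` (`j < m+K`, `η = (d−1)·2L^j·δ`).  §4 ★★ `exists_flatGauge_nbhd` (`j+1 < m+K`, `η = (d−1)·3L^{j+1}·δ`).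
* §5 ★★ `norm_pertVar_iter_le_of_plaqBound`, ★★★ `twoBlockMass_le_of_plaqBound` — the `μ_j` binder of ✓ `…CurvedLandauCoreFibreT3` ∕ ✓ `…CurvedLandauCoreFinalT3`
  now reads: the (14) bound, the competitor's sup `ρ`, and the four smallness rows at `η = (d−1)·3L^{j+1}·δ` (k-UNIFORM: with `δ = ε·L^{−2(K−n)}`, `j + 1 ≤ K − n`,
  `(d+1)L^j·η ≤ 3(d²−1)·ε∕L`).
HONEST SCOPE.  Lattice bookkeeping + two knits; the Poincaré lemma itself is the tree's.  No constant is optimised (corner-rooted comb, uniform box).  Branch-independent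
((P)∕(Λ)-neutral).  Not touched: `ρ` (a route datum, `s = ε₂ℓ⁻¹`), the ℓ² masses `‖Y_j‖` (the `C_reg` input), `(δ, Z)`.

References: T. Bałaban, CMP 98 (1985) 17–51 [Balaban1985Averaging] ((44)–(45) p.24, p.24 l.−2 – p.25 l.2; Prop. 4 (134)–(135) p.38); CMP 109 (1987) 249–301
[Balaban1987RG1] ((0.3)–(0.4) pp.252–253, (1.11)–(1.12) p.262); CMP 102 (1985) 277–309 [Balaban1985Variational] ((14)–(15) p.280).
-/

set_option autoImplicit false

noncomputable section

open scoped BigOperators Matrix.Norms.L2Operator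

namespace Summit.QuantumFields.YangMills.Theorems.Prop7FibreLevelSupLocalGauge

open Literature.MathematicalPhysics.QuantumFieldTheory.Balaban1983to89
open Literature.MathematicalPhysics.QuantumFieldTheory.Balaban1983to89.B5Eq118OneStroke (iterBlockOf iterBlockOf_succ val_iterBlockOf)
open Literature.MathematicalPhysics.QuantumFieldTheory.Balaban1983to89.T4AxialGaugeSmallField
  (castSite castSite_apply castSite_add_e pull pull_apply axialGauge gaugeAct_axialGauge_castSite castSite_injOn_box BoxPlaqSmall
   dist1_axial_bond_le_uniform hol_pull_plaqWord_of_lt hol_pull_plaqWord_of_gt)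
open B7Prop1Explicit (e e_apply)
open B8Lemma1NonAbelian (e_nonneg)

variable {P : Params}

/-! ## §1 Lattice bookkeeping: the finest sites over a (shifted) coarse block, read in a box of `ℤ^d` -/

/-- `2·L^j < sitesPerDir 0` for `j < m + K`. [folklore] -/
theorem two_mul_pow_lt_sitesPerDir_zero {j : ℕ} (hj : j < P.m + P.K) : 2 * P.L ^ j < P.sitesPerDir 0 := by
  unfold Params.sitesPerDir
  have h1 : P.L ^ j < P.L ^ (P.m + P.K) := Nat.pow_lt_pow_right P.hL.2 hj
  rw [Nat.sub_zero]; omega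

/-- `3·L^{j+1} < sitesPerDir 0` for `j + 1 < m + K` (uses `3 ≤ L`, `L` odd `> 1`). [folklore] -/
theorem three_mul_pow_lt_sitesPerDir_zero {j : ℕ} (hj : j + 1 < P.m + P.K) : 3 * P.L ^ (j + 1) < P.sitesPerDir 0 := by
  unfold Params.sitesPerDir
  have hL3 : 3 ≤ P.L := by
    obtain ⟨hodd, h1⟩ := P.hL
    rcases hodd with ⟨r, hr⟩
    omega
  have h1 : P.L ^ (j + 2) ≤ P.L ^ (P.m + P.K) := Nat.pow_le_pow_right P.L_pos (by omega)
  have h2 : 3 * P.L ^ (j + 1) ≤ P.L ^ (j + 2) := by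
    rw [show j + 2 = (j + 1) + 1 by ring, pow_succ]
    calc 3 * P.L ^ (j + 1) = P.L ^ (j + 1) * 3 := by ring
      _ ≤ P.L ^ (j + 1) * P.L := Nat.mul_le_mul_left _ hL3
  have h3 : 0 < P.L ^ (j + 1) := Nat.pow_pos P.L_pos
  rw [Nat.sub_zero]; omega

/-- THE REPRESENTATIVE OF A FINE SITE OVER A SHIFTED COARSE BLOCK.  `k ≤ m + K`; `w` a site of `T^{(k)}`, `t : Fin d → ℕ` a multi-shift; if the
`k`-fold block point of `x ∈ T^{(0)}` is `w + t` (coordinatewise in `ZMod`), then `x = castSite z` for an integer vector `z` with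
`z_μ ∈ [((w_μ).val + t_μ)·L^k, ((w_μ).val + t_μ + 1)·L^k − 1]` (labels NOT reduced modulo the period — the wrap is absorbed by `castSite`). [folklore] -/
theorem exists_rep_of_iterBlockOf {k : ℕ} (hk : k ≤ P.m + P.K) (w : Site P k) (t : Fin P.d → ℕ) (x : Site P 0)
    (hx : ∀ μ, (iterBlockOf k x) μ = w μ + ((t μ : ℕ) : ZMod (P.sitesPerDir k))) :
    ∃ z : Fin P.d → ℤ, (∀ μ, (((w μ).val + t μ : ℕ) : ℤ) * (P.L : ℤ) ^ k ≤ z μ ∧ z μ + 1 ≤ ((((w μ).val + t μ : ℕ) : ℤ) + 1) * (P.L : ℤ) ^ k) ∧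
      (castSite z : Site P 0) = x := by
  have hLk : 0 < P.L ^ k := Nat.pow_pos P.L_pos
  -- `N_0 = N_k · L^k` in the standing range (as in ✓ `BIJ85Ineq722Torus.sitesPerDir_zero_eq`, not imported to keep this file's closure inside the gauge branch)
  have hN0 : P.sitesPerDir 0 = P.sitesPerDir k * P.L ^ k := by
    unfold Params.sitesPerDir
    have h : P.m + P.K - 0 = (P.m + P.K - k) + k := by omega
    rw [h, pow_add]; ring
  refine ⟨fun μ => (((w μ).val + t μ : ℕ) : ℤ) * (P.L : ℤ) ^ k + (((x μ).val % P.L ^ k : ℕ) : ℤ), fun μ => ⟨?_, ?_⟩, ?_⟩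
  · simp only [le_add_iff_nonneg_right]; positivity
  · have h1 : (x μ).val % P.L ^ k + 1 ≤ P.L ^ k := Nat.mod_lt _ hLk
    have h2 : ((((x μ).val % P.L ^ k : ℕ) : ℤ)) + 1 ≤ (P.L : ℤ) ^ k := by exact_mod_cast h1
    linarith
  · funext μ
    rw [castSite_apply]
    have hq : (x μ).val / P.L ^ k = ((iterBlockOf k x) μ).val := (val_iterBlockOf k hk x μ).symm
    have hq' : ((iterBlockOf k x) μ).val = ((w μ).val + t μ) % P.sitesPerDir k := by
      rw [hx μ, ZMod.val_add, ZMod.val_natCast, Nat.add_mod_mod]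
    have hv : (x μ).val = P.L ^ k * (((w μ).val + t μ) % P.sitesPerDir k) + (x μ).val % P.L ^ k := by
      rw [← hq', ← hq]; exact (Nat.div_add_mod _ _).symm
    -- `(a % N_k) * L^k ≡ a * L^k (mod N_0)` since `N_0 = N_k · L^k`
    have hcast : (((((w μ).val + t μ) % P.sitesPerDir k) * P.L ^ k : ℕ) : ZMod (P.sitesPerDir 0))
        = ((((w μ).val + t μ) * P.L ^ k : ℕ) : ZMod (P.sitesPerDir 0)) := by
      rw [ZMod.natCast_eq_natCast_iff', hN0, Nat.mul_mod_mul_right, Nat.mul_mod_mul_right, Nat.mod_mod]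
    have e1 : ((((((w μ).val + t μ : ℕ) : ℤ) * (P.L : ℤ) ^ k + (((x μ).val % P.L ^ k : ℕ) : ℤ) : ℤ)) : ZMod (P.sitesPerDir 0))
        = (((w μ).val + t μ : ℕ) : ZMod (P.sitesPerDir 0)) * ((P.L : ℕ) : ZMod (P.sitesPerDir 0)) ^ k
          + (((x μ).val % P.L ^ k : ℕ) : ZMod (P.sitesPerDir 0)) := by
      simp only [Int.cast_add, Int.cast_mul, Int.cast_pow, Int.cast_natCast]
    have hcast' : (((w μ).val + t μ : ℕ) : ZMod (P.sitesPerDir 0)) * ((P.L : ℕ) : ZMod (P.sitesPerDir 0)) ^ k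
        = ((((w μ).val + t μ) % P.sitesPerDir k : ℕ) : ZMod (P.sitesPerDir 0)) * ((P.L : ℕ) : ZMod (P.sitesPerDir 0)) ^ k := by
      simpa only [Nat.cast_mul, Nat.cast_pow] using hcast.symm
    have hv' : (((x μ).val : ℕ) : ZMod (P.sitesPerDir 0))
        = ((((w μ).val + t μ) % P.sitesPerDir k : ℕ) : ZMod (P.sitesPerDir 0)) * ((P.L : ℕ) : ZMod (P.sitesPerDir 0)) ^ k
          + (((x μ).val % P.L ^ k : ℕ) : ZMod (P.sitesPerDir 0)) := by
      conv_lhs => rw [hv]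
      simp only [Nat.cast_add, Nat.cast_mul, Nat.cast_pow]; ring
    rw [e1, hcast', ← hv', ZMod.natCast_zmod_val]

/-- … hence such an `x` lies in the image `castSite '' [lo, hi]` of any integer box containing the label range of the shifted block. [folklore] -/
theorem mem_image_box_of_iterBlockOf {k : ℕ} (hk : k ≤ P.m + P.K) (w : Site P k) (t : Fin P.d → ℕ) (x : Site P 0)
    (hx : ∀ μ, (iterBlockOf k x) μ = w μ + ((t μ : ℕ) : ZMod (P.sitesPerDir k))) {lo hi : Fin P.d → ℤ}
    (hlo : ∀ μ, lo μ ≤ (((w μ).val + t μ : ℕ) : ℤ) * (P.L : ℤ) ^ k) (hhi : ∀ μ, ((((w μ).val + t μ : ℕ) : ℤ) + 1) * (P.L : ℤ) ^ k ≤ hi μ + 1) :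
    x ∈ (castSite '' Set.Icc lo hi : Set (Site P 0)) := by
  obtain ⟨z, hz, hzx⟩ := exists_rep_of_iterBlockOf hk w t x hx
  exact ⟨z, ⟨fun μ => (hlo μ).trans (hz μ).1, fun μ => by have := (hz μ).2; have := hhi μ; linarith⟩, hzx⟩

/-! ## §2 The axial gauge of a non-wrapping box is flat on the image of the box (any `GaugeGroup`, any level; `≤`-form of the plaquette bound) -/

section AnyGroup

variable {i : ℕ} {G : Type*} [GaugeGroup G]

/-- The `≤`-form of the box plaquette hypothesis for the periodic pullback: `dist1 (U(∂p)) ≤ δ` for ALL torus plaquettes gives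
`BoxPlaqSmall (pull U) lo hi δ` on every box (both orientations; `≤`-twin of ✓ `T4AxialGaugeSmallField.boxPlaqSmall_pull`). [folklore] -/
theorem boxPlaqSmall_pull_of_le (U : GaugeField P i G) (lo hi : Fin P.d → ℤ) {δ : ℝ}
    (hU : ∀ p : Plaq P i, dist1 (GaugeField.plaqHol U p) ≤ δ) : BoxPlaqSmall (pull U) lo hi δ := by
  intro z κ μ hκμ _ _
  rcases lt_or_gt_of_ne hκμ with h | h
  · rw [hol_pull_plaqWord_of_lt U z h]; exact hU _
  · rw [hol_pull_plaqWord_of_gt U z h, GaugeGroup.dist1_inv]; exact hU _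

/-- **THE AXIAL GAUGE OF A BOX IS FLAT ON THE IMAGE OF THE BOX.**  `U` any gauge field on `T^{(i)}` with `dist1 (U(∂p)) ≤ δ` for every plaquette (`0 ≤ δ`);
`[lo, hi] ⊂ ℤ^d` a box of at most `n + 1` sites per direction with the injectivity margin `n + 1 < sitesPerDir i`; `N = castSite '' [lo, hi]` its image
on the torus.  THEN every positively oriented bond `e` with BOTH ends in `N` satisfies `dist1 (U^{σ}(e)) ≤ (d − 1)·n·δ` for `σ = axialGauge U lo hi`
(the torus non-abelian Poincaré lemma ✓ `T4AxialGaugeSmallField.dist1_axial_bond_le_uniform`, BY NAME; the margin identifies `e` as a box bond). [folklore] -/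
theorem dist1_gaugeAct_axialGauge_le_of_mem_image (U : GaugeField P i G) {lo hi : Fin P.d → ℤ} {δ : ℝ} {n : ℕ}
    (hU : ∀ p : Plaq P i, dist1 (GaugeField.plaqHol U p) ≤ δ) (hδ : 0 ≤ δ) (hn : ∀ κ, hi κ ≤ lo κ + n) (hnN : n + 1 < P.sitesPerDir i)
    (e' : PBond P i) (hs : e'.src ∈ (castSite '' Set.Icc lo hi : Set (Site P i))) (ht : e'.tgt ∈ (castSite '' Set.Icc lo hi : Set (Site P i))) :
    dist1 (GaugeField.gaugeAct (axialGauge U lo hi) U e') ≤ ((P.d - 1 : ℕ) : ℝ) * n * δ := by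
  obtain ⟨src, dir⟩ := e'
  obtain ⟨z, ⟨hzlo, hzhi⟩, hz⟩ := hs
  obtain ⟨z', ⟨hz'lo, hz'hi⟩, hz'⟩ := ht
  simp only at hz hz'
  subst hz
  -- the target is `castSite (z + e_dir)`; injectivity on the box `[lo, hi + 1]` identifies it with `z'`, so `z + e_dir ≤ hi`
  have htgt : (PBond.tgt ⟨castSite z, dir⟩ : Site P i) = castSite (z + e dir) := by
    rw [castSite_add_e]; rfl
  have hN1 : ∀ κ, (hi κ + 1) - lo κ < P.sitesPerDir i := fun κ => by
    have h1 := hn κ; have h2 : ((n : ℕ) : ℤ) + 1 < (P.sitesPerDir i : ℤ) := by exact_mod_cast hnN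
    linarith
  have hze : lo ≤ z + e dir := hzlo.trans (le_add_of_nonneg_right (e_nonneg dir))
  have hze' : z + e dir ≤ fun κ => hi κ + 1 := fun κ => by
    have h1 := hzhi κ; simp only [Pi.add_apply, e_apply]; split_ifs <;> linarith
  have hz'' : z' ≤ fun κ => hi κ + 1 := fun κ => by have := hz'hi κ; simp only; linarith
  have heq : z' = z + e dir := castSite_injOn_box hN1 hz'lo hz'' hze hze' (hz'.trans htgt)
  have hzμ : z + e dir ≤ hi := heq ▸ hz'hi
  have hN : ∀ κ, hi κ - lo κ < P.sitesPerDir i := fun κ => by have := hN1 κ; linarith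
  rw [gaugeAct_axialGauge_castSite U hN hzlo hzμ]
  exact dist1_axial_bond_le_uniform (pull U) (boxPlaqSmall_pull_of_le U lo hi hU) hδ hn z dir hzlo hzμ


/-! ## §3 Two adjacent `j`-blocks: the stencil of ✓ `Prop7FibreLevelSup.norm_pertVar_iter_le_of_gauge` -/

/-- `(y + e_ν)_μ = y_μ + [μ = ν]` on `T^{(k)}`. [folklore] -/
theorem shift_apply_eq_add {k : ℕ} (y : Site P k) (ν μ : Fin P.d) :
    (y.shift ν) μ = y μ + (((if μ = ν then 1 else 0 : ℕ)) : ZMod (P.sitesPerDir k)) := by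
  simp only [Site.shift, Function.update_apply]
  split_ifs with h
  · subst h; simp
  · simp

/-- One more unit step: if `y = w + t₀` coordinatewise and `s ∈ {y, y + e_ν}`, then `s = w + t` with `t ≤ t₀ + 1`. [folklore] -/
theorem exists_multishift_of_eq_or_eq_shift {k : ℕ} (w y s : Site P k) (ν : Fin P.d) (t₀ : Fin P.d → ℕ)
    (hy : ∀ μ, y μ = w μ + ((t₀ μ : ℕ) : ZMod (P.sitesPerDir k))) (hs : s = y ∨ s = y.shift ν) :
    ∃ t : Fin P.d → ℕ, (∀ μ, t μ ≤ t₀ μ + 1) ∧ ∀ μ, s μ = w μ + ((t μ : ℕ) : ZMod (P.sitesPerDir k)) := by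
  rcases hs with rfl | rfl
  · exact ⟨t₀, fun μ => Nat.le_succ _, hy⟩
  · refine ⟨fun μ => t₀ μ + (if μ = ν then 1 else 0), fun μ => by show t₀ μ + (if μ = ν then 1 else 0) ≤ t₀ μ + 1; split_ifs <;> omega, fun μ => ?_⟩
    rw [shift_apply_eq_add, hy μ]; push_cast; ring

variable {i : ℕ} {G : Type*} [GaugeGroup G]

/-- ★ **A FLAT GAUGE OVER TWO ADJACENT `j`-BLOCKS FROM THE PLAQUETTE BOUND.**  `j < m + K` (so the union of the two blocks does not wrap around
`T^{(0)}`); `U₀` any gauge field on the finest torus with `dist1 (U₀(∂p)) ≤ δ` for every plaquette; `b` a bond of `T^{(j)}`.  THEN there are a finest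
gauge transformation `σ` and a stencil `N ⊇ B^j(b₋) ∪ B^j(b₊)` such that `U₀^σ` is `(d − 1)·2L^j·δ`-flat on the finest bonds with both ends in `N`
(`σ` = the axial gauge of the integer box of labels `[b₋·L^j, b₋·L^j + 2L^j − 1]`, `N` its image) — the `(σ, N, hN, hU₀)` input of
✓ `Prop7FibreLevelSup.norm_pertVar_iter_le_of_gauge` DISCHARGED from the (14)-type plaquette bound. [folklore] -/
theorem exists_flatGauge_twoBlocks {j : ℕ} (hj : j < P.m + P.K) (U₀ : GaugeField P 0 G) {δ : ℝ} (hδ : 0 ≤ δ)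
    (hU : ∀ p : Plaq P 0, dist1 (GaugeField.plaqHol U₀ p) ≤ δ) (b : PBond P j) :
    ∃ (σ : GaugeTransf P 0 G) (N : Set (Site P 0)),
      (∀ x : Site P 0, (iterBlockOf j x = b.src ∨ iterBlockOf j x = b.tgt) → x ∈ N) ∧
      ∀ e' : PBond P 0, e'.src ∈ N → e'.tgt ∈ N → dist1 (GaugeField.gaugeAct σ U₀ e') ≤ ((P.d - 1 : ℕ) : ℝ) * (2 * (P.L : ℝ) ^ j) * δ := by
  have hLj : 1 ≤ P.L ^ j := Nat.one_le_pow _ _ P.L_pos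
  obtain ⟨n', hn'⟩ : ∃ n' : ℕ, n' + 1 = 2 * P.L ^ j := ⟨2 * P.L ^ j - 1, by omega⟩
  have hnN : n' + 1 < P.sitesPerDir 0 := hn' ▸ two_mul_pow_lt_sitesPerDir_zero hj
  have hn'R : ((n' : ℕ) : ℝ) ≤ 2 * (P.L : ℝ) ^ j := by exact_mod_cast (show n' ≤ 2 * P.L ^ j by omega)
  have hn'Z : ((n' : ℕ) : ℤ) + 1 = 2 * (P.L : ℤ) ^ j := by exact_mod_cast hn'
  let lo : Fin P.d → ℤ := fun μ => (((b.src μ).val : ℕ) : ℤ) * (P.L : ℤ) ^ j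
  let hi : Fin P.d → ℤ := fun μ => lo μ + n'
  refine ⟨axialGauge U₀ lo hi, castSite '' Set.Icc lo hi, fun x hx => ?_, fun e' hs ht => ?_⟩
  · -- the two blocks are `b₋ + t`, `t ∈ {0, e_dir}`
    have key : ∃ t : Fin P.d → ℕ, (∀ μ, t μ ≤ 0 + 1) ∧ ∀ μ, (iterBlockOf j x) μ = b.src μ + ((t μ : ℕ) : ZMod (P.sitesPerDir j)) :=
      exists_multishift_of_eq_or_eq_shift b.src b.src (iterBlockOf j x) b.dir (fun _ => 0) (fun μ => by simp) hx
    obtain ⟨t, ht1, ht⟩ := key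
    refine mem_image_box_of_iterBlockOf hj.le b.src t x ht (fun μ => ?_) (fun μ => ?_)
    · have h0 : (0 : ℤ) ≤ ((t μ : ℕ) : ℤ) * (P.L : ℤ) ^ j := by positivity
      show (((b.src μ).val : ℕ) : ℤ) * (P.L : ℤ) ^ j ≤ _
      push_cast; linarith
    · have h1 : ((t μ : ℕ) : ℤ) ≤ 1 := by exact_mod_cast ht1 μ
      have h2 : ((t μ : ℕ) : ℤ) * (P.L : ℤ) ^ j ≤ 1 * (P.L : ℤ) ^ j := mul_le_mul_of_nonneg_right h1 (by positivity)
      show _ ≤ (((b.src μ).val : ℕ) : ℤ) * (P.L : ℤ) ^ j + n' + 1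
      push_cast; nlinarith
  · refine (dist1_gaugeAct_axialGauge_le_of_mem_image U₀ hU hδ (fun κ => le_rfl) hnN e' hs ht).trans ?_
    have hd : (0 : ℝ) ≤ ((P.d - 1 : ℕ) : ℝ) := Nat.cast_nonneg _
    calc ((P.d - 1 : ℕ) : ℝ) * n' * δ = ((P.d - 1 : ℕ) : ℝ) * (n' * δ) := by ring
      _ ≤ ((P.d - 1 : ℕ) : ℝ) * ((2 * (P.L : ℝ) ^ j) * δ) := mul_le_mul_of_nonneg_left (mul_le_mul_of_nonneg_right hn'R hδ) hd
      _ = ((P.d - 1 : ℕ) : ℝ) * (2 * (P.L : ℝ) ^ j) * δ := by ring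

/-! ## §4 The two-block neighbourhood of a `(j+1)`-bond: the stencil of ✓ `Prop7FibreLevelSup.twoBlockMass_le_of_gauge` -/

/-- ★ **A FLAT GAUGE OVER THE TWO-BLOCK NEIGHBOURHOOD OF A `(j+1)`-BOND FROM THE PLAQUETTE BOUND.**  `j + 1 < m + K`; `U₀` with `dist1 (U₀(∂p)) ≤ δ` for every
plaquette of `T^{(0)}`; `c` a bond of `T^{(j+1)}`.  THEN there are `σ` and a stencil `N` containing the two `j`-blocks of EVERY `j`-bond `b` with
`blockOf b₋ ∈ {c₋, c₊}` such that `U₀^σ` is `(d − 1)·3L^{j+1}·δ`-flat on the finest bonds with both ends in `N` (`σ` = the axial gauge of the box of labels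
`[c₋·L^{j+1}, c₋·L^{j+1} + 3L^{j+1} − 1]`) — the `(σ, N, hN, hU₀)` input of ✓ `Prop7FibreLevelSup.twoBlockMass_le_of_gauge` DISCHARGED. [folklore] -/
theorem exists_flatGauge_nbhd {j : ℕ} (hj : j + 1 < P.m + P.K) (U₀ : GaugeField P 0 G) {δ : ℝ} (hδ : 0 ≤ δ)
    (hU : ∀ p : Plaq P 0, dist1 (GaugeField.plaqHol U₀ p) ≤ δ) (c : PBond P (j + 1)) :
    ∃ (σ : GaugeTransf P 0 G) (N : Set (Site P 0)),
      (∀ b : PBond P j, (blockOf b.src = c.src ∨ blockOf b.src = c.tgt) →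
        ∀ x : Site P 0, (iterBlockOf j x = b.src ∨ iterBlockOf j x = b.tgt) → x ∈ N) ∧
      ∀ e' : PBond P 0, e'.src ∈ N → e'.tgt ∈ N → dist1 (GaugeField.gaugeAct σ U₀ e') ≤ ((P.d - 1 : ℕ) : ℝ) * (3 * (P.L : ℝ) ^ (j + 1)) * δ := by
  have hLj : 1 ≤ P.L ^ (j + 1) := Nat.one_le_pow _ _ P.L_pos
  obtain ⟨n', hn'⟩ : ∃ n' : ℕ, n' + 1 = 3 * P.L ^ (j + 1) := ⟨3 * P.L ^ (j + 1) - 1, by omega⟩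
  have hnN : n' + 1 < P.sitesPerDir 0 := hn' ▸ three_mul_pow_lt_sitesPerDir_zero hj
  have hn'R : ((n' : ℕ) : ℝ) ≤ 3 * (P.L : ℝ) ^ (j + 1) := by exact_mod_cast (show n' ≤ 3 * P.L ^ (j + 1) by omega)
  have hn'Z : ((n' : ℕ) : ℤ) + 1 = 3 * (P.L : ℤ) ^ (j + 1) := by exact_mod_cast hn'
  let lo : Fin P.d → ℤ := fun μ => (((c.src μ).val : ℕ) : ℤ) * (P.L : ℤ) ^ (j + 1)
  let hi : Fin P.d → ℤ := fun μ => lo μ + n'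
  refine ⟨axialGauge U₀ lo hi, castSite '' Set.Icc lo hi, fun b hb x hx => ?_, fun e' hs ht => ?_⟩
  · -- `blockOf b₋ = c₋ + t₁`, `t₁ ≤ 1`; `B(iterBlockOf j x) ∈ {blockOf b₋, blockOf b₋ + e_{dir b}}`; so `iterBlockOf (j+1) x = c₋ + t`, `t ≤ 2`
    obtain ⟨t₁, ht₁, hy⟩ := exists_multishift_of_eq_or_eq_shift c.src c.src (blockOf b.src) c.dir (fun _ => 0) (fun μ => by simp) hb
    have hs : iterBlockOf (j + 1) x = blockOf b.src ∨ iterBlockOf (j + 1) x = (blockOf b.src).shift b.dir := by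
      rw [iterBlockOf_succ]
      rcases hx with h | h
      · exact Or.inl (by rw [h])
      · rw [h, PBond.tgt, B10StarCount.blockOf_shift (by omega) b.src b.dir]
        split_ifs
        · exact Or.inr rfl
        · exact Or.inl rfl
    obtain ⟨t, ht2, ht⟩ := exists_multishift_of_eq_or_eq_shift c.src (blockOf b.src) (iterBlockOf (j + 1) x) b.dir t₁ hy hs
    refine mem_image_box_of_iterBlockOf (by omega) c.src t x ht (fun μ => ?_) (fun μ => ?_)
    · have h0 : (0 : ℤ) ≤ ((t μ : ℕ) : ℤ) * (P.L : ℤ) ^ (j + 1) := by positivity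
      show (((c.src μ).val : ℕ) : ℤ) * (P.L : ℤ) ^ (j + 1) ≤ _
      push_cast; linarith
    · have h1 : ((t μ : ℕ) : ℤ) ≤ 2 := by have := ht2 μ; have := ht₁ μ; exact_mod_cast (by omega : t μ ≤ 2)
      have h2 : ((t μ : ℕ) : ℤ) * (P.L : ℤ) ^ (j + 1) ≤ 2 * (P.L : ℤ) ^ (j + 1) := mul_le_mul_of_nonneg_right h1 (by positivity)
      show _ ≤ (((c.src μ).val : ℕ) : ℤ) * (P.L : ℤ) ^ (j + 1) + n' + 1
      push_cast; nlinarith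
  · refine (dist1_gaugeAct_axialGauge_le_of_mem_image U₀ hU hδ (fun κ => le_rfl) hnN e' hs ht).trans ?_
    have hd : (0 : ℝ) ≤ ((P.d - 1 : ℕ) : ℝ) := Nat.cast_nonneg _
    calc ((P.d - 1 : ℕ) : ℝ) * n' * δ = ((P.d - 1 : ℕ) : ℝ) * (n' * δ) := by ring
      _ ≤ ((P.d - 1 : ℕ) : ℝ) * ((3 * (P.L : ℝ) ^ (j + 1)) * δ) := mul_le_mul_of_nonneg_left (mul_le_mul_of_nonneg_right hn'R hδ) hd
      _ = ((P.d - 1 : ℕ) : ℝ) * (3 * (P.L : ℝ) ^ (j + 1)) * δ := by ring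

end AnyGroup


/-! ## §5 `SU(n)`: the two theorems of ✓ `Prop7FibreLevelSup` with the local-gauge input DISCHARGED from the plaquette bound -/

section SU

open Finset BlockAveraging ExpMeanLog
open BlockAveragingEMLLinearisedBackground (pertVar)
open Summit.QuantumFields.YangMills.Theorems.Prop7FibreLevelSup (norm_pertVar_iter_le_of_gauge twoBlockMass_le_of_gauge)

variable {n : Type*} [Fintype n] [DecidableEq n] [Nonempty n]

/-- ★★ **THE LEVEL-`j` RATIO IS SMALL WHEREVER THE PAIR IS CLOSE — FROM THE PLAQUETTE BOUND ALONE.**  `j < m + K`; `U₀` with `dist1 (U₀(∂p)) ≤ δ` for every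
plaquette of `T^{(0)}` (the route's (14)-type bound, `δ = ε·ℓ⁻²`) and `‖W_e − U₀,e‖ ≤ ρ` on every finest bond; the four smallness rows of ✓ `norm_pertVar_iter_le_of_gauge`
at `η := (d − 1)·2L^j·δ`.  THEN `‖pertVar Ū₀^{(j)} W̄^{(j)} (b)‖ ≤ 2·((d+1)L^j·ρ)` — ✓ `Prop7FibreLevelSup.norm_pertVar_iter_le_of_gauge` with `(σ, N, hN, hU₀)`
supplied by `exists_flatGauge_twoBlocks`. [cite: Balaban1985Averaging, (11)–(13) p.19, Prop. 4 (134)–(135) p.38; Balaban1987RG1, (1.11)–(1.12) p.262] -/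
theorem norm_pertVar_iter_le_of_plaqBound {j : ℕ} (hj : j < P.m + P.K) (b : PBond P j)
    (W U₀ : GaugeField P 0 (Matrix.specialUnitaryGroup n ℂ)) {ρ δ : ℝ} (hρ0 : 0 ≤ ρ) (hδ0 : 0 ≤ δ)
    (hU : ∀ p : Plaq P 0, dist1 (GaugeField.plaqHol U₀ p) ≤ δ)
    (hρ : ∀ e : PBond P 0, ‖((W e : Matrix.specialUnitaryGroup n ℂ) : Matrix n n ℂ) - ((U₀ e : Matrix.specialUnitaryGroup n ℂ) : Matrix n n ℂ)‖ ≤ ρ)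
    (hmδ : (((P.d : ℝ) + 1) * ((18 : ℝ) ^ P.d * (2 + ((P.d : ℝ) + 1) * (18 : ℝ) ^ P.d)) * (324 * (((P.d + 2) * P.L : ℕ) : ℝ) ^ 2) /
        ((P.L : ℝ) * ((P.L : ℝ) - 1))) * (((P.d : ℝ) + 1) * (P.L : ℝ) ^ j * (((P.d - 1 : ℕ) : ℝ) * (2 * (P.L : ℝ) ^ j) * δ)) ≤ 1)
    (h200 : 200 * (((P.d + 2) * P.L : ℕ) : ℝ) * ((((P.d : ℝ) + 1) * (P.L : ℝ) ^ j * ρ) + (((P.d : ℝ) + 1) * (P.L : ℝ) ^ j * (((P.d - 1 : ℕ) : ℝ) * (2 * (P.L : ℝ) ^ j) * δ))) ≤ 1)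
    (hm : (((P.d : ℝ) + 1) * ((18 : ℝ) ^ P.d * (2 + ((P.d : ℝ) + 1) * (18 : ℝ) ^ P.d)) * (5200 * (((P.d + 2) * P.L : ℕ) : ℝ) ^ 2) /
        ((P.L : ℝ) * ((P.L : ℝ) - 1))) * ((((P.d : ℝ) + 1) * (P.L : ℝ) ^ j * ρ) + (((P.d : ℝ) + 1) * (P.L : ℝ) ^ j * (((P.d - 1 : ℕ) : ℝ) * (2 * (P.L : ℝ) ^ j) * δ))) ≤ 1)
    (hNδ : 4 * (((P.d + 2) * P.L : ℕ) : ℝ) * ((((P.d : ℝ) + 1) * (P.L : ℝ) ^ j * ρ) + (((P.d : ℝ) + 1) * (P.L : ℝ) ^ j * (((P.d - 1 : ℕ) : ℝ) * (2 * (P.L : ℝ) ^ j) * δ))) < deltaSU n) :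
    ‖pertVar (Averaging.iter (fun i => blockAvg (P := P) (j := i) (expMeanLogSU (n := n))) j U₀) (Averaging.iter (fun i => blockAvg (P := P) (j := i) (expMeanLogSU (n := n))) j W) b‖
      ≤ 2 * (((P.d : ℝ) + 1) * (P.L : ℝ) ^ j * ρ) := by
  obtain ⟨σ, N, hN, hflat⟩ := exists_flatGauge_twoBlocks hj U₀ hδ0 hU b
  exact norm_pertVar_iter_le_of_gauge hj.le σ N b hN W U₀ hρ0 (by positivity) (fun e h1 h2 => hflat e h1 h2) (fun e _ _ => hρ e) hmδ h200 hm hNδ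

/-- ★★ **THE TWO-BLOCK MASS `μ_j` OF FILE C FROM THE PLAQUETTE BOUND ALONE.**  `j + 1 < m + K`; `c` a `(j+1)`-bond; hypotheses as above with the rows at
`η := (d − 1)·3L^{j+1}·δ`.  THEN `(d+2)L·Σ_{b∈N(c)}‖pertVar Ū₀^{(j)} W̄^{(j)} (b)‖ ≤ (d+2)L·(2dL^d)·(2(d+1)L^jρ)` — ✓ `Prop7FibreLevelSup.twoBlockMass_le_of_gauge` with
`(σ, N, hN, hU₀)` supplied by `exists_flatGauge_nbhd`: the `μ_j` binder of ✓ `…CurvedLandauCoreFibreT3`∕`…CoreFinalT3` reads the (14) bound and the competitor's sup only.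
[cite: Balaban1985Averaging, Prop. 4 (134)–(135) p.38; Balaban1987RG1, (0.3)–(0.4) pp.252–253, (1.11)–(1.12) p.262] -/
theorem twoBlockMass_le_of_plaqBound {j : ℕ} (hj : j + 1 < P.m + P.K) (c : PBond P (j + 1))
    (W U₀ : GaugeField P 0 (Matrix.specialUnitaryGroup n ℂ)) {ρ δ : ℝ} (hρ0 : 0 ≤ ρ) (hδ0 : 0 ≤ δ)
    (hU : ∀ p : Plaq P 0, dist1 (GaugeField.plaqHol U₀ p) ≤ δ)
    (hρ : ∀ e : PBond P 0, ‖((W e : Matrix.specialUnitaryGroup n ℂ) : Matrix n n ℂ) - ((U₀ e : Matrix.specialUnitaryGroup n ℂ) : Matrix n n ℂ)‖ ≤ ρ)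
    (hmδ : (((P.d : ℝ) + 1) * ((18 : ℝ) ^ P.d * (2 + ((P.d : ℝ) + 1) * (18 : ℝ) ^ P.d)) * (324 * (((P.d + 2) * P.L : ℕ) : ℝ) ^ 2) /
        ((P.L : ℝ) * ((P.L : ℝ) - 1))) * (((P.d : ℝ) + 1) * (P.L : ℝ) ^ j * (((P.d - 1 : ℕ) : ℝ) * (3 * (P.L : ℝ) ^ (j + 1)) * δ)) ≤ 1)
    (h200 : 200 * (((P.d + 2) * P.L : ℕ) : ℝ) * ((((P.d : ℝ) + 1) * (P.L : ℝ) ^ j * ρ) + (((P.d : ℝ) + 1) * (P.L : ℝ) ^ j * (((P.d - 1 : ℕ) : ℝ) * (3 * (P.L : ℝ) ^ (j + 1)) * δ))) ≤ 1)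
    (hm : (((P.d : ℝ) + 1) * ((18 : ℝ) ^ P.d * (2 + ((P.d : ℝ) + 1) * (18 : ℝ) ^ P.d)) * (5200 * (((P.d + 2) * P.L : ℕ) : ℝ) ^ 2) /
        ((P.L : ℝ) * ((P.L : ℝ) - 1))) * ((((P.d : ℝ) + 1) * (P.L : ℝ) ^ j * ρ) + (((P.d : ℝ) + 1) * (P.L : ℝ) ^ j * (((P.d - 1 : ℕ) : ℝ) * (3 * (P.L : ℝ) ^ (j + 1)) * δ))) ≤ 1)
    (hNδ : 4 * (((P.d + 2) * P.L : ℕ) : ℝ) * ((((P.d : ℝ) + 1) * (P.L : ℝ) ^ j * ρ) + (((P.d : ℝ) + 1) * (P.L : ℝ) ^ j * (((P.d - 1 : ℕ) : ℝ) * (3 * (P.L : ℝ) ^ (j + 1)) * δ))) < deltaSU n) :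
    (((P.d + 2) * P.L : ℕ) : ℝ) * ∑ b ∈ (univ.filter (fun b : PBond P j => blockOf b.src = c.src ∨ blockOf b.src = c.tgt)), ‖pertVar (Averaging.iter (fun i => blockAvg (P := P) (j := i) (expMeanLogSU (n := n))) j U₀) (Averaging.iter (fun i => blockAvg (P := P) (j := i) (expMeanLogSU (n := n))) j W) b‖
      ≤ (((P.d + 2) * P.L : ℕ) : ℝ) * ((2 * P.d * (P.L : ℝ) ^ P.d) * (2 * (((P.d : ℝ) + 1) * (P.L : ℝ) ^ j * ρ))) := by
  obtain ⟨σ, N, hN, hflat⟩ := exists_flatGauge_nbhd hj U₀ hδ0 hU c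
  exact twoBlockMass_le_of_gauge (by omega) c σ N hN W U₀ hρ0 (by positivity) (fun e h1 h2 => hflat e h1 h2) (fun e _ _ => hρ e) hmδ h200 hm hNδ

end SU

end Summit.QuantumFields.YangMills.Theorems.Prop7FibreLevelSupLocalGauge

end
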